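import Mathlib
import HarnessLib
import Literature.MathematicalPhysics.StatisticalMechanics.WeightDominatingStep
import Literature.MathematicalPhysics.StatisticalMechanics.WeightShellBounds
import Literature.MathematicalPhysics.StatisticalMechanics.WeightMultiplierGrowth
import Literature.MathematicalPhysics.StatisticalMechanics.TorusFRDShellForm

/-!
# Lemma 7.3 at one Fourier mode from the shell bounds (Adams–Buchholz–Kotecký–Müller, Lemma 7.3)

Assembly of the scalar step inequality `h73` of `WeightData.dominated_of_multipliers`
(`WeightDominatingMultipliers.lean`),

  `(lam·m_k⁻¹ + (1+θ_k) t')⁻¹ + δ·m_{k+1} ≤ (lam·m_{k+1}⁻¹ + (1+θ_k−μδ) t')⁻¹`,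
  `t' = Σ_{j=k+2}^{N+1} c_j(p)`, `m_k = derivMul L k s`,

at a mode `p = p(κ) ≠ 0` lying in the shell `𝔸_{j'}`, from the (v)-shaped shell bounds
(`GradientFRD.ShellBoundsV`) of the finite-range decomposition and the inversion of the symbol by
the total multiplier (`(Σ_j c_j)·â = 1`), following the two regimes of [ABKM19] Remark 7.4:
HIGH momenta `j' + k₀ + 1 ≤ k` via `step_high` ((7.34) `four_mul_derivMul_le_succ`, (7.35)
`tail_sum_le`/`two_mul_tail_le_inv`), LOW momenta `k ≤ j' + k₀` via `step_low` ((7.37)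
`tail_ge_far/near`, `tail_le_inv_symb`, `inv_symbR_le`, (7.38) `momNorm_sq_le_derivMul`,
`derivMul_le_of_momNorm_le`).  The numerical side conditions on the parameters
(`lam, μ, δ, k₀, θ_k`) appear as explicit hypotheses ((7.31), (7.40), (7.44)–(7.45)).

* `derivMul_le_shell` — (7.38) on a shell: `m_{k'}(p) ≤ S(k'−j')·dπ²/Lsq^{j'}`,
  `S(e) = Σ_{α∈s} (π√d L^e)^{2(|α|−1)}`;
* **`step_of_shellBoundsV`** — the inequality above for `k + 1 ≤ N`.

Everything is proved; no named fact.

## References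
* S. Adams, S. Buchholz, R. Kotecký, S. Müller, arXiv:1910.13564, Lemma 7.3 with Remark 7.4,
  (7.31)–(7.45) [AdamsBuchholzKoteckyMuller2019].
-/

noncomputable section

namespace Literature.MathematicalPhysics.StatisticalMechanics.GradientRG

open Finset Real
open Literature.MathematicalPhysics.StatisticalMechanics.GradientFRD
  (qmode qpow qnormSq momNorm symbR IsElliptic InShell ShellBoundsV cExt momNorm_nonneg momNorm_sq_le
    lt_momNorm_of_inShell momNorm_le_of_inShell inv_momNorm_sq_le_of_inShell cExt_le_of_shellBoundsV
    cExt_nonneg cExt_of_mem)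

variable {d M : ℕ} [NeZero M]

/-- The constant of (7.38) at relative scale `e`: `S(e) = Σ_{α∈s} (π√d·L^e)^{2(|α|−1)}`.
[cite: AdamsBuchholzKoteckyMuller2019, Lemma 7.3 (7.38)] -/
def shellConst (s : Finset (Fin d → ℕ)) (L : ℝ) (e : ℕ) : ℝ :=
  ∑ α ∈ s, (π * Real.sqrt d * L ^ e) ^ (2 * (∑ i, α i - 1))

/-- `S(e)` is monotone in `e` for `L ≥ 1`. [cite: AdamsBuchholzKoteckyMuller2019, Lemma 7.3 (7.38)] -/
theorem shellConst_mono (s : Finset (Fin d → ℕ)) {L : ℝ} (hL : 1 ≤ L) {e e' : ℕ} (h : e ≤ e') :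
    shellConst s L e ≤ shellConst s L e' := by
  unfold shellConst
  refine sum_le_sum fun α _ => pow_le_pow_left₀ (by positivity) ?_ _
  exact mul_le_mul_of_nonneg_left (pow_le_pow_right₀ hL h) (by positivity)

/-- `S(e) ≥ 0`. [cite: AdamsBuchholzKoteckyMuller2019, Lemma 7.3 (7.38)] -/
theorem shellConst_nonneg (s : Finset (Fin d → ℕ)) {L : ℝ} (hL : 0 ≤ L) (e : ℕ) :
    0 ≤ shellConst s L e := by
  unfold shellConst
  exact sum_nonneg fun α _ => by positivity

/-- On the shell `𝔸_{j'}`: `|p| ≤ π√d · (L^{j'})⁻¹` (for `j' ≥ 1` from the shell, for `j' = 0` from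
`|p|² ≤ dπ²`; needs `d ≥ 1`, `L ≥ 1`). [cite: AdamsBuchholzKoteckyMuller2019, Lemma 7.3 (7.38)] -/
theorem momNorm_le_shell {L : ℕ} (hL : 1 ≤ L) (hd : 1 ≤ d) {j' : ℕ} {κ : Fin d → ZMod M}
    (hj : InShell L j' κ) : momNorm κ ≤ π * Real.sqrt d * ((L : ℝ) ^ j')⁻¹ := by
  have hπd : 1 ≤ π * Real.sqrt d := by
    have h1 : (1 : ℝ) ≤ Real.sqrt d := by
      rw [show (1 : ℝ) = Real.sqrt 1 by simp]
      exact Real.sqrt_le_sqrt (by exact_mod_cast hd)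
    nlinarith [Real.pi_gt_three]
  rcases Nat.eq_zero_or_pos j' with h0 | hpos
  · subst h0
    rw [pow_zero, inv_one, mul_one]
    have h := momNorm_sq_le κ
    have hp := momNorm_nonneg κ
    have : momNorm κ ≤ Real.sqrt (d * π ^ 2) := Real.le_sqrt_of_sq_le h
    rw [Real.sqrt_mul (by positivity), Real.sqrt_sq Real.pi_pos.le] at this
    linarith [this]
  · have h := momNorm_le_of_inShell hL hj hpos le_rfl
    have hLpos : (0 : ℝ) < ((L : ℝ) ^ j')⁻¹ := by
      have : (0:ℝ) < (L:ℝ) := by exact_mod_cast (show 0 < L by omega)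
      positivity
    calc momNorm κ ≤ ((L : ℝ) ^ j')⁻¹ := h
      _ = 1 * ((L : ℝ) ^ j')⁻¹ := (one_mul _).symm
      _ ≤ π * Real.sqrt d * ((L : ℝ) ^ j')⁻¹ := mul_le_mul_of_nonneg_right hπd hLpos.le

/-- **(7.38) on a shell**: for `p ∈ 𝔸_{j'}`, `j' ≤ k'`:
`m_{k'}(p) ≤ S(k'−j') · dπ² / Lsq^{j'}`. [cite: AdamsBuchholzKoteckyMuller2019, Lemma 7.3 (7.38)] -/
theorem derivMul_le_shell {L : ℕ} (hL : 1 ≤ L) (hd : 1 ≤ d) {s : Finset (Fin d → ℕ)}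
    (hs : ∀ α ∈ s, 1 ≤ ∑ i, α i) {j' k' : ℕ} (hj'k : j' ≤ k') {κ : Fin d → ZMod M}
    (hj : InShell L j' κ) :
    derivMul (L : ℝ) k' s κ ≤ shellConst s (L : ℝ) (k' - j') * (d * π ^ 2) / ((L : ℝ) ^ 2) ^ j' := by
  have hL0 : (0 : ℝ) ≤ (L : ℝ) := by positivity
  have hLpos : (0 : ℝ) < (L : ℝ) := by exact_mod_cast (show 0 < L by omega)
  have hρ := momNorm_le_shell hL hd hj
  have h1 := derivMul_le_of_momNorm_le hL0 k' hs hρ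
  -- `L^{k'} ρ = π√d L^{k'−j'}`
  have hprod : (L : ℝ) ^ k' * (π * Real.sqrt d * ((L : ℝ) ^ j')⁻¹) = π * Real.sqrt d * (L : ℝ) ^ (k' - j') := by
    have : (L : ℝ) ^ k' = (L : ℝ) ^ (k' - j') * (L : ℝ) ^ j' := by
      rw [← pow_add, Nat.sub_add_cancel hj'k]
    rw [this]; field_simp
  rw [hprod] at h1
  -- `|p|² ≤ dπ² / Lsq^{j'}`
  have hp2 : momNorm κ ^ 2 ≤ d * π ^ 2 / ((L : ℝ) ^ 2) ^ j' := by
    have h2 : momNorm κ ^ 2 ≤ (π * Real.sqrt d * ((L : ℝ) ^ j')⁻¹) ^ 2 :=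
      pow_le_pow_left₀ (momNorm_nonneg κ) hρ 2
    have h3 : (π * Real.sqrt d * ((L : ℝ) ^ j')⁻¹) ^ 2 = d * π ^ 2 / ((L : ℝ) ^ 2) ^ j' := by
      rw [mul_pow, mul_pow, Real.sq_sqrt (by positivity), inv_pow, ← pow_mul, mul_comm j' 2, pow_mul]
      ring
    rw [h3] at h2; exact h2
  calc derivMul (L : ℝ) k' s κ ≤ shellConst s (L : ℝ) (k' - j') * momNorm κ ^ 2 := h1
    _ ≤ shellConst s (L : ℝ) (k' - j') * (d * π ^ 2 / ((L : ℝ) ^ 2) ^ j') :=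
        mul_le_mul_of_nonneg_left hp2 (shellConst_nonneg s hL0 _)
    _ = shellConst s (L : ℝ) (k' - j') * (d * π ^ 2) / ((L : ℝ) ^ 2) ^ j' := by ring

/-- **Lemma 7.3 at one mode** ([ABKM19] (7.45)).  Data at the mode `κ ≠ 0` in the shell `𝔸_{j'}`:
(v)-shaped shell bounds for the coefficients `f j = 𝒞̂_j(p)` (`ShellBoundsV`, constants `c, C ≥ 0`),
the inversion `(Σ_{j=1}^{N+1} Re f_j)·â(p) = 1` of an `(ω₀,Ω₀)`-elliptic symbol, an index set `s` of
orders in `[1, M]` containing `e_i, 2e_i`, `L ≥ 2` with `3dπ² ≤ 4(L²−4)`, and parameters with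
`lam > 0`, `0 ≤ δ ≤ (4 lam)⁻¹`, `0 ≤ μδ ≤ 1+θ`, `−1 ≤ θ ≤ 1`, the high-momentum smallness
`4 C_up S(e) dπ² ≤ lam B^{e+1}` for `e ≥ k₀+2` (choice of `k₀`, `n ≥ 2M`) and the low-momentum
largeness `K (Ω₁+Ω₂)² ≤ μ ω₁` ((7.40)).  Then for `k + 1 ≤ N`:
`(lam·m_k⁻¹ + (1+θ)t')⁻¹ + δ m_{k+1} ≤ (lam·m_{k+1}⁻¹ + (1+θ−μδ)t')⁻¹`.
[cite: AdamsBuchholzKoteckyMuller2019, Lemma 7.3] -/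
theorem step_of_shellBoundsV {L : ℕ} (hL2 : 2 ≤ L) (hd : 1 ≤ d) {n ñ N : ℕ} (hdn : 1 ≤ d - 1 + n)
    {c C : ℝ}
    (hc : 0 ≤ c) (hC : 0 ≤ C) {κ : Fin d → ZMod M} (hκ : κ ≠ 0) {j' : ℕ} (hj : InShell L j' κ)
    (hj'N : j' ≤ N) {f : ℕ → ℂ} (hv : ShellBoundsV d n ñ N j' (L : ℝ) c C f)
    {ω₀ Ω₀ : ℝ} {A : Matrix (Fin d) (Fin d) ℝ} (hA : IsElliptic ω₀ Ω₀ A) (hω : 0 < ω₀)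
    (hinv : (∑ j ∈ Icc 1 (N + 1), cExt N f j) * symbR A κ = 1)
    {s : Finset (Fin d → ℕ)} (hs : ∀ α ∈ s, 1 ≤ ∑ i, α i)
    (hs1 : ∀ i : Fin d, (Pi.single i 1 : Fin d → ℕ) ∈ s)
    (hs2 : ∀ i : Fin d, (Pi.single i 2 : Fin d → ℕ) ∈ s)
    (hLd : 3 * (d : ℝ) * π ^ 2 ≤ 4 * ((L : ℝ) ^ 2 - 4))
    {lam θ δ μ : ℝ} (hlam : 0 < lam) (hθ : 0 ≤ 1 + θ) (hθ1 : θ ≤ 1) (hδ0 : 0 ≤ δ)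
    (hδ : δ ≤ (4 * lam)⁻¹) (hμ0 : 0 ≤ μ) (hμδ : μ * δ ≤ 1 + θ)
    {k k₀ : ℕ} (hkN : k + 1 ≤ N)
    (hsmall : ∀ e : ℕ, k₀ + 2 ≤ e →
      4 * (C * (L : ℝ) ^ (2 * (d + ñ) + 1)) * (shellConst s (L : ℝ) e * (d * π ^ 2)) ≤
        lam * ((L : ℝ) ^ (d - 1 + n)) ^ (e + 1))
    (hlarge : shellConst s (L : ℝ) (k₀ + 1) * (d * π ^ 2) *
        ((1 + θ) * (ω₀ * (4 / π ^ 2))⁻¹ + lam * (4 / π ^ 2)⁻¹) ^ 2 ≤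
      μ * ((c / (L : ℝ) ^ (2 * (d + ñ) + 1)) / ((L : ℝ) ^ 2 * ((L : ℝ) ^ (d - 1 + n)) ^ (k₀ + 2)))) :
    (lam * (derivMul (L : ℝ) k s κ)⁻¹ + (1 + θ) * ∑ j ∈ Icc (k + 2) (N + 1), cExt N f j)⁻¹ +
        δ * derivMul (L : ℝ) (k + 1) s κ ≤
      (lam * (derivMul (L : ℝ) (k + 1) s κ)⁻¹ +
        (1 + θ - μ * δ) * ∑ j ∈ Icc (k + 2) (N + 1), cExt N f j)⁻¹ := by
  -- common facts
  have hL1 : 1 ≤ L := by omega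
  have hLr0 : (0 : ℝ) ≤ (L : ℝ) := by positivity
  have hLr1 : (1 : ℝ) ≤ (L : ℝ) := by exact_mod_cast hL1
  have hLr2 : (2 : ℝ) ≤ (L : ℝ) := by exact_mod_cast hL2
  have hLpos : (0 : ℝ) < (L : ℝ) := by linarith
  set Lsq : ℝ := (L : ℝ) ^ 2 with hLsq
  set B : ℝ := (L : ℝ) ^ (d - 1 + n) with hBdef
  set Cup : ℝ := C * (L : ℝ) ^ (2 * (d + ñ) + 1) with hCup
  set clow : ℝ := c / (L : ℝ) ^ (2 * (d + ñ) + 1) with hclow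
  set t' : ℝ := ∑ j ∈ Icc (k + 2) (N + 1), cExt N f j with ht'def
  have hLsq0 : 0 < Lsq := by positivity
  have hLsq1 : 1 ≤ Lsq := one_le_pow₀ hLr1
  have hB1 : 1 ≤ B := one_le_pow₀ hLr1
  have hB0 : 0 < B := by linarith
  have hB2 : 2 ≤ B := hLr2.trans (le_self_pow₀ hLr1 (by omega))
  have hdπ : (1 : ℝ) ≤ d * π ^ 2 := by
    have h1 : (1 : ℝ) ≤ d := by exact_mod_cast hd
    nlinarith [Real.pi_gt_three]
  have hCup0 : 0 ≤ Cup := by positivity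
  have hclow0 : 0 ≤ clow := by positivity
  have hcnn : ∀ j, 0 ≤ cExt N f j := fun j => cExt_nonneg hv hc hLr0 j
  have ht'0 : 0 ≤ t' := sum_nonneg fun j _ => hcnn j
  have hmk : 0 < derivMul (L : ℝ) k s κ := derivMul_pos hLr0 k hs1 hκ
  have hmk1 : 0 < derivMul (L : ℝ) (k + 1) s κ := derivMul_pos hLr0 (k + 1) hs1 hκ
  have hmono : derivMul (L : ℝ) k s κ ≤ derivMul (L : ℝ) (k + 1) s κ :=
    derivMul_mono hLr1 (Nat.le_succ k) s κ
  have hp0 : 0 < momNorm κ := lt_of_le_of_lt (by positivity) (lt_momNorm_of_inShell hj)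
  rcases le_or_gt (j' + k₀ + 1) k with hhigh | hlow
  · -- HIGH momenta: `j' + k₀ + 1 ≤ k`
    have hj'k : j' + 1 ≤ k := by omega
    -- (7.34)
    have h34 : 4 * derivMul (L : ℝ) k s κ ≤ derivMul (L : ℝ) (k + 1) s κ := by
      refine four_mul_derivMul_le_succ hLr2 hLd k hs hs1 hs2 ?_
      have h1 := lt_momNorm_of_inShell hj
      have h2 : ((L : ℝ) ^ k)⁻¹ ≤ ((L : ℝ) ^ (j' + 1))⁻¹ :=
        inv_anti₀ (pow_pos hLpos _) (pow_le_pow_right₀ hLr1 hj'k)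
      exact h2.trans h1.le
    -- (7.35): tail and the bound on `m_{k+1}`
    have htail : t' ≤ 2 * Cup * Lsq ^ j' / B ^ (k + 2 - j') :=
      tail_sum_le hB2 hCup0 hLsq0.le (by omega)
        (fun j hj'j => cExt_le_of_shellBoundsV hv hC hLr0 j hj'j)
    have hmle : derivMul (L : ℝ) (k + 1) s κ ≤
        (shellConst s (L : ℝ) (k + 1 - j') * (d * π ^ 2)) / Lsq ^ j' := by
      have := derivMul_le_shell hL1 hd hs (show j' ≤ k + 1 by omega) hj
      rwa [hLsq]
    have h35 : 2 * t' ≤ lam * (derivMul (L : ℝ) (k + 1) s κ)⁻¹ := by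
      refine two_mul_tail_le_inv (K := shellConst s (L : ℝ) (k + 1 - j')) (G := d * π ^ 2)
        hB0 hLsq0 hmk1 htail hmle hCup0 ?_
      have hsm := hsmall (k + 1 - j') (by omega)
      have he : k + 1 - j' + 1 = k + 2 - j' := by omega
      rw [he] at hsm
      exact hsm
    -- conclude with `step_high`, `ε' = θ − μδ`
    have hμδ0 : 0 ≤ μ * δ := mul_nonneg hμ0 hδ0
    have := step_high (ε := θ) (ε' := θ - μ * δ) hlam hmk hmk1 ht'0 hθ (by linarith) (by linarith)
      h34 h35 hδ
    have h' : (1 : ℝ) + (θ - μ * δ) = 1 + θ - μ * δ := by ring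
    rw [h'] at this
    exact this
  · -- LOW momenta: `k ≤ j' + k₀`
    have hr : 0 < (momNorm κ ^ 2)⁻¹ := by positivity
    -- (7.37) lower bound `ω₁ r ≤ t'`
    have hpr : (momNorm κ ^ 2)⁻¹ ≤ Lsq * Lsq ^ j' := inv_momNorm_sq_le_of_inShell hL1 hj
    have hω₁ : clow / (Lsq * B ^ (k₀ + 2)) * (momNorm κ ^ 2)⁻¹ ≤ t' := by
      rcases le_or_gt (k + 2) j' with hfar | hnear
      · -- far: the term `j = j'`
        have hLo : clow * Lsq ^ j' ≤ cExt N f j' := by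
          rw [cExt_of_mem (by omega) (by omega)]
          exact ShellBoundsV.le_re_of_le hv (by omega) (by omega) le_rfl
        have h := tail_ge_far (c := cExt N f) (j' := j') (k := k) (N := N) (r := momNorm κ ^ 2)
          hcnn hclow0 hLsq0 hfar (by omega) hLo hpr
        -- `clow/(Lsq B^{k₀+2}) ≤ clow/Lsq`
        have hcmp : clow / (Lsq * B ^ (k₀ + 2)) ≤ clow / Lsq :=
          div_le_div_of_nonneg_left hclow0 hLsq0 (le_mul_of_one_le_right hLsq0.le (one_le_pow₀ hB1))
        exact (mul_le_mul_of_nonneg_right hcmp hr.le).trans h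
      · -- near: the term `j = k+2`
        have hLo : clow * Lsq ^ j' / B ^ (k + 2 - j') ≤ cExt N f (k + 2) := by
          rw [cExt_of_mem (by omega) (by omega)]
          exact ShellBoundsV.le_re_of_lt hv (by omega) (by omega) hnear
        exact tail_ge_near (c := cExt N f) (j' := j') (k := k) (k₀ := k₀) (N := N)
          (r := momNorm κ ^ 2) hcnn hclow0 hLsq0 hB1 (by omega) (by omega) hLo hpr
    -- (7.37) upper bound `(1+θ) t' ≤ Ω₁ r`
    have hΩ₁ : (1 + θ) * t' ≤ (1 + θ) * (ω₀ * (4 / π ^ 2))⁻¹ * (momNorm κ ^ 2)⁻¹ := by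
      have h1 : t' ≤ (symbR A κ)⁻¹ :=
        tail_le_inv_symb (s := Icc 1 (N + 1)) (fun j hj => by
          have := (mem_Icc.1 hj); exact mem_Icc.2 ⟨by omega, this.2⟩) (fun j _ => hcnn j) hinv
      have h2 := inv_symbR_le hA hω hκ
      have h3 : (ω₀ * (4 / π ^ 2 * momNorm κ ^ 2))⁻¹ = (ω₀ * (4 / π ^ 2))⁻¹ * (momNorm κ ^ 2)⁻¹ := by
        rw [← mul_inv, mul_assoc]
      rw [mul_assoc]
      exact mul_le_mul_of_nonneg_left (h1.trans (h2.trans_eq h3)) hθ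
    -- (7.38): `lam m⁻¹ ≤ Ω₂ r` and `m ≤ K r⁻¹`
    have hΩ₂ : lam * (derivMul (L : ℝ) (k + 1) s κ)⁻¹ ≤ lam * (4 / π ^ 2)⁻¹ * (momNorm κ ^ 2)⁻¹ := by
      have h1 := momNorm_sq_le_derivMul hLr0 (k + 1) hs1 κ
      have h2 : (derivMul (L : ℝ) (k + 1) s κ)⁻¹ ≤ (4 / π ^ 2 * momNorm κ ^ 2)⁻¹ :=
        inv_anti₀ (by positivity) h1
      calc lam * (derivMul (L : ℝ) (k + 1) s κ)⁻¹ ≤ lam * (4 / π ^ 2 * momNorm κ ^ 2)⁻¹ :=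
            mul_le_mul_of_nonneg_left h2 hlam.le
        _ = lam * (4 / π ^ 2)⁻¹ * (momNorm κ ^ 2)⁻¹ := by rw [mul_inv, mul_assoc]
    have hK : derivMul (L : ℝ) (k + 1) s κ ≤
        shellConst s (L : ℝ) (k₀ + 1) * (d * π ^ 2) * ((momNorm κ ^ 2)⁻¹)⁻¹ := by
      rw [inv_inv]
      have hρ := momNorm_le_shell hL1 hd hj
      have hSK : ∀ e, e ≤ k₀ + 1 → shellConst s (L : ℝ) e ≤ shellConst s (L : ℝ) (k₀ + 1) * (d * π ^ 2) :=
        fun e he => (shellConst_mono s hLr1 he).trans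
          (le_mul_of_one_le_right (shellConst_nonneg s hLr0 _) hdπ)
      rcases le_or_gt j' (k + 1) with hle | hgt
      · have h1 := derivMul_le_of_momNorm_le hLr0 (k + 1) hs hρ
        have hprod : (L : ℝ) ^ (k + 1) * (π * Real.sqrt d * ((L : ℝ) ^ j')⁻¹) =
            π * Real.sqrt d * (L : ℝ) ^ (k + 1 - j') := by
          have : (L : ℝ) ^ (k + 1) = (L : ℝ) ^ (k + 1 - j') * (L : ℝ) ^ j' := by
            rw [← pow_add, Nat.sub_add_cancel hle]
          rw [this]; field_simp
        rw [hprod] at h1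
        exact h1.trans (mul_le_mul_of_nonneg_right (hSK _ (by omega)) (sq_nonneg _))
      · -- `j' > k+1`: use `ρ = π√d (L^{k+1})⁻¹`
        have hρ' : momNorm κ ≤ π * Real.sqrt d * ((L : ℝ) ^ (k + 1))⁻¹ := by
          refine hρ.trans (mul_le_mul_of_nonneg_left ?_ (by positivity))
          exact inv_anti₀ (pow_pos hLpos _) (pow_le_pow_right₀ hLr1 hgt.le)
        have h1 := derivMul_le_of_momNorm_le hLr0 (k + 1) hs hρ'
        have hprod : (L : ℝ) ^ (k + 1) * (π * Real.sqrt d * ((L : ℝ) ^ (k + 1))⁻¹) =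
            π * Real.sqrt d * (L : ℝ) ^ 0 := by
          rw [pow_zero, mul_one]; field_simp
        rw [hprod] at h1
        exact h1.trans (mul_le_mul_of_nonneg_right (hSK 0 (Nat.zero_le _)) (sq_nonneg _))
    -- conclude with `step_low`
    exact step_low hlam hmk hmono hr hδ0 hμδ hμ0 hω₁ hΩ₁ hΩ₂ hK hlarge (by positivity)

end Literature.MathematicalPhysics.StatisticalMechanics.GradientRG

end
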